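import Mathlib.Analysis.Calculus.Deriv.Prod
import Mathlib.Analysis.Calculus.Deriv.Mul
import Mathlib.Analysis.Calculus.ContDiff.Basic
import Literature.Analysis.FunctionSpaces.TorusEnstrophyOrthogonality
import Literature.Analysis.FunctionSpaces.TorusSpaceTime
import HarnessLib

/-!
# Chain rules on the flat torus and the `C¹` divergence theorem

Pointwise calculus on `𝕋ᵈ` (`TorusCalculus.lean`) for COMPOSITIONS `y ↦ g (a y) (b y)` of torus
functions `a, b : 𝕋ᵈ → ℝ` with a function `g` of two real variables that is only `Cⁿ` on an OPEN
SET `U ⊆ ℝ²` containing the values `(a y, b y)` — the situation of constitutive functions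
`p(ρ,ϑ), e(ρ,ϑ), s(ρ,ϑ)` of compressible fluid mechanics, which are smooth on `(0,∞)²` only:

* `Torus.partialDeriv_comp₂` — `∂ᵢ[g(a,b)] = ∂₁g ∂ᵢa + ∂₂g ∂ᵢb`;
* `Torus.isContDiff_comp₂` — `y ↦ g (a y) (b y)` is `C¹` on the torus;
* `Torus.timeDerivWithin_comp₂` — the same chain rule for one-sided time derivatives of
  space–time fields;
* `Torus.partialDeriv_half_norm_sq` — `∂ᵢ(½|u|²) = ∑ₖ uₖ ∂ᵢuₖ` (coordinates of gradients are
  `Torus.gradient_apply` of `TorusMollifierEstimates.lean`, not duplicated here);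
* `Torus.integral_partialDeriv_eq_zero_of_isContDiff`, `Torus.integral_divergence_eq_zero_of_isContDiff`
  — integration by parts on the torus for `C¹` (not necessarily smooth) functions, and the
  product rule `div(f u) = f div u + u·∇f` (`Torus.divergence_smul`).

## Overlap to be consolidated

The two preliminary lemmas `hasFDerivAt_uncurry_of_contDiffOn` and `hasDerivWithinAt_comp₂`
(slice calculus of a `Cⁿ` function of two real variables on an open set) generalize / duplicate
the `TwoVar` section of `Literature/Analysis/FluidPDE/BallisticFreeEnergy.lean`
(`hasFDerivAt_uncurry`, `fderiv_uncurry_apply`, `hasDerivAt_comp₂`; here `HasDerivWithinAt`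
instead of `HasDerivAt`). They are repeated because `FunctionSpaces` may not import `FluidPDE`;
nothing in them is torus- or fluid-specific, and a librarian should move both copies into one
generic `Analysis` file and retire the duplicates.

## References

* L. C. Evans, *Partial Differential Equations* (2010), App. C.2 (Gauss–Green on domains without
  boundary terms); L. Grafakos, *Classical Fourier Analysis* (2014), §3.1.
-/

noncomputable section

open MeasureTheory Set Filter Function
open scoped Topology InnerProductSpace

namespace Literature.Analysis.FunctionSpaces

namespace Torus

variable {d : Type*} [Fintype d] [DecidableEq d]

/-! ## Two-variable compositions -/

section Comp

variable {g : ℝ → ℝ → ℝ} {U : Set (ℝ × ℝ)} {n : WithTop ℕ∞}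

omit [Fintype d] [DecidableEq d] in
/-- A `Cⁿ` (`n ≥ 1`) function of two variables on an open set: Fréchet derivative at a point of
the set, expressed through the one-variable slice derivatives. [folklore] -/
theorem hasFDerivAt_uncurry_of_contDiffOn (hg : ContDiffOn ℝ n (uncurry g) U) (hU : IsOpen U)
    (hn : 1 ≤ n) {r θ : ℝ} (h : (r, θ) ∈ U) :
    HasFDerivAt (uncurry g) (_root_.fderiv ℝ (uncurry g) (r, θ)) (r, θ) ∧
    ∀ a b : ℝ, _root_.fderiv ℝ (uncurry g) (r, θ) (a, b) =
      deriv (fun ρ => g ρ θ) r * a + deriv (fun τ => g r τ) θ * b := by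
  have hF : HasFDerivAt (uncurry g) (_root_.fderiv ℝ (uncurry g) (r, θ)) (r, θ) :=
    ((hg.differentiableOn (by positivity)).differentiableAt (hU.mem_nhds h)).hasFDerivAt
  refine ⟨hF, fun a b => ?_⟩
  have h1 : deriv (fun ρ => g ρ θ) r = _root_.fderiv ℝ (uncurry g) (r, θ) (1, 0) := by
    have hc := hF.comp r (hasFDerivAt_prodMk_left (𝕜 := ℝ) r θ)
    have hd := hc.hasDerivAt
    simpa [Function.comp_def] using hd.deriv
  have h2 : deriv (fun τ => g r τ) θ = _root_.fderiv ℝ (uncurry g) (r, θ) (0, 1) := by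
    have hc := hF.comp θ (hasFDerivAt_prodMk_right (𝕜 := ℝ) r θ)
    have hd := hc.hasDerivAt
    simpa [Function.comp_def] using hd.deriv
  rw [h1, h2]
  have : ((a, b) : ℝ × ℝ) = a • (1, 0) + b • (0, 1) := by ext <;> simp
  rw [this, map_add, map_smul, map_smul, smul_eq_mul, smul_eq_mul]
  ring

omit [Fintype d] [DecidableEq d] in
/-- One-variable chain rule through a `Cⁿ` function of two variables:
`d/dt g(a t, b t) = ∂₁g a' + ∂₂g b'` (within a set). [folklore] -/
theorem hasDerivWithinAt_comp₂ (hg : ContDiffOn ℝ n (uncurry g) U) (hU : IsOpen U) (hn : 1 ≤ n)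
    {a b : ℝ → ℝ} {a' b' t : ℝ} {s : Set ℝ} (h : (a t, b t) ∈ U)
    (ha : HasDerivWithinAt a a' s t) (hb : HasDerivWithinAt b b' s t) :
    HasDerivWithinAt (fun τ => g (a τ) (b τ))
      (deriv (fun ρ => g ρ (b t)) (a t) * a' + deriv (fun θ => g (a t) θ) (b t) * b') s t := by
  obtain ⟨hF, hF'⟩ := hasFDerivAt_uncurry_of_contDiffOn hg hU hn h
  have hc := hF.comp_hasDerivWithinAt t (ha.prodMk hb)
  rw [hF'] at hc
  exact hc

/-- **Chain rule for partial derivatives on the torus**: for `C¹` torus functions `a, b` with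
values in an open set `U` on which `g` is `Cⁿ` (`n ≥ 1`),
`∂ᵢ[g(a,b)](x) = ∂₁g(a x, b x) ∂ᵢa(x) + ∂₂g(a x, b x) ∂ᵢb(x)`. [folklore] -/
theorem partialDeriv_comp₂ (hg : ContDiffOn ℝ n (uncurry g) U) (hU : IsOpen U) (hn : 1 ≤ n)
    {a b : UnitAddTorus d → ℝ} (ha : IsContDiff 1 a) (hb : IsContDiff 1 b) (x : UnitAddTorus d)
    (hx : (a x, b x) ∈ U) (i : d) :
    partialDeriv i (fun y => g (a y) (b y)) x =
      deriv (fun ρ => g ρ (b x)) (a x) * partialDeriv i a x +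
        deriv (fun θ => g (a x) θ) (b x) * partialDeriv i b x := by
  unfold partialDeriv lineDeriv
  set v : EuclideanSpace ℝ d := EuclideanSpace.single i 1
  have ha' : HasDerivAt (fun s : ℝ => a (x + proj (s • v))) (Torus.lineDeriv a x v) 0 := by
    simpa using hasDerivAt_comp_add_proj_smul ha x v 0
  have hb' : HasDerivAt (fun s : ℝ => b (x + proj (s • v))) (Torus.lineDeriv b x v) 0 := by
    simpa using hasDerivAt_comp_add_proj_smul hb x v 0
  have hx0 : (a (x + proj ((0 : ℝ) • v)), b (x + proj ((0 : ℝ) • v))) ∈ U := by simpa using hx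
  have h := hasDerivWithinAt_comp₂ (s := univ) hg hU hn hx0 ha'.hasDerivWithinAt
    hb'.hasDerivWithinAt
  rw [hasDerivWithinAt_univ] at h
  rw [h.deriv]
  simp [Torus.lineDeriv]

omit [DecidableEq d] in
/-- Compositions `y ↦ g (a y) (b y)` with `C¹` torus functions valued in `U` are `C¹` on the
torus. [folklore] -/
theorem isContDiff_comp₂ (hg : ContDiffOn ℝ n (uncurry g) U) (hn : 1 ≤ n)
    {a b : UnitAddTorus d → ℝ} (ha : IsContDiff 1 a) (hb : IsContDiff 1 b)
    (hU : ∀ x, (a x, b x) ∈ U) : IsContDiff 1 (fun y => g (a y) (b y)) := by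
  have h : lift (fun y => g (a y) (b y)) = uncurry g ∘ fun v => (lift a v, lift b v) := by
    funext v; rfl
  unfold IsContDiff
  rw [h]
  exact (hg.of_le hn).comp_contDiff (ha.prodMk hb) fun v => hU _

omit [Fintype d] [DecidableEq d] in
/-- **Chain rule for one-sided time derivatives** of compositions of space–time fields with a
`Cⁿ` function of two variables. [folklore] -/
theorem timeDerivWithin_comp₂ [Fintype d] (hg : ContDiffOn ℝ n (uncurry g) U) (hU : IsOpen U)
    (hn : 1 ≤ n) {S : Set ℝ} {a b : ℝ → UnitAddTorus d → ℝ} (ha : IsSmoothSpaceTimeOn S a)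
    (hb : IsSmoothSpaceTimeOn S b) (hS : UniqueDiffOn ℝ S) {t : ℝ} (ht : t ∈ S)
    (x : UnitAddTorus d) (hx : (a t x, b t x) ∈ U) :
    timeDerivWithin S (fun s y => g (a s y) (b s y)) t x =
      deriv (fun ρ => g ρ (b t x)) (a t x) * timeDerivWithin S a t x +
        deriv (fun θ => g (a t x) θ) (b t x) * timeDerivWithin S b t x :=
  (hasDerivWithinAt_comp₂ hg hU hn hx (ha.hasDerivWithinAt_slice ht x)
    (hb.hasDerivWithinAt_slice ht x)).derivWithin (hS t ht)

end Comp

/-! ## Partial derivatives of `½‖u‖²` and the product rule for the divergence -/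

/-- `∂ᵢ(½‖u‖²)(x) = ∑ₖ uₖ(x) ∂ᵢuₖ(x)` for `C¹` vector fields. [folklore] -/
theorem partialDeriv_half_norm_sq {u : UnitAddTorus d → EuclideanSpace ℝ d} (hu : IsContDiff 1 u)
    (i : d) (x : UnitAddTorus d) :
    partialDeriv i (fun y => ‖u y‖ ^ 2 / 2) x = ∑ k, u x k * partialDeriv i (fun y => u y k) x := by
  have hsq : IsContDiff 1 (fun y => ‖u y‖ ^ 2) := hu.norm_sq ℝ
  have h1 : partialDeriv i (fun y => ‖u y‖ ^ 2 / 2) x = partialDeriv i (fun y => ‖u y‖ ^ 2) x / 2 := by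
    have : (fun y => ‖u y‖ ^ 2 / 2) = fun y => (fun _ : UnitAddTorus d => (1 / 2 : ℝ)) y • ‖u y‖ ^ 2 := by
      funext y; simp [div_eq_inv_mul]
    rw [this, partialDeriv_smul (isContDiff_const _) hsq]
    have h0 : partialDeriv i (fun _ : UnitAddTorus d => (1 / 2 : ℝ)) x = 0 := by
      simp [partialDeriv, Torus.lineDeriv]
    rw [h0]
    simp [div_eq_inv_mul, mul_comm]
  rw [h1, partialDeriv_eq_fderiv_apply hsq, fderiv_norm_sq_apply hu,
    ← partialDeriv_eq_fderiv_apply hu]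
  rw [show (2 : ℝ) * ⟪u x, partialDeriv i u x⟫_ℝ / 2 = ⟪u x, partialDeriv i u x⟫_ℝ by ring]
  rw [PiLp.inner_apply]
  refine Finset.sum_congr rfl fun k _ => ?_
  rw [partialDeriv_apply_coord hu i x k]
  simp [mul_comm]

/-- Product rule for the divergence: `div(f u)(x) = f(x) div u(x) + ∑ᵢ uᵢ(x) ∂ᵢf(x)` for `C¹`
`f`, `u`. [folklore] -/
theorem divergence_smul {f : UnitAddTorus d → ℝ} {u : UnitAddTorus d → EuclideanSpace ℝ d}
    (hf : IsContDiff 1 f) (hu : IsContDiff 1 u) (x : UnitAddTorus d) :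
    divergence (fun y => f y • u y) x = f x * divergence u x + ∑ i, u x i * partialDeriv i f x := by
  unfold divergence
  rw [Finset.mul_sum, ← Finset.sum_add_distrib]
  refine Finset.sum_congr rfl fun i _ => ?_
  have hui : IsContDiff 1 (fun y => u y i) :=
    (EuclideanSpace.proj i : EuclideanSpace ℝ d →L[ℝ] ℝ).contDiff.comp hu
  have : (fun y => (f y • u y) i) = fun y => f y * u y i := by funext y; simp
  rw [this, partialDeriv_mul hf hui]
  ring

/-! ## Integration by parts for `C¹` functions -/

section IBP

variable {F : Type*} [NormedAddCommGroup F] [NormedSpace ℝ F]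

omit [DecidableEq d] in
/-- `∫_{𝕋ᵈ} ∂ᵥ f = 0` for `C¹` `f` (the translates `s ↦ ∫ f(x + s v) dx` are constant by
translation invariance, and may be differentiated under the integral sign since `∂ᵥf` is
continuous on the compact torus). [cite: Evans2010, App. C.2 Thm. 1] -/
theorem integral_lineDeriv_eq_zero_of_isContDiff {f : UnitAddTorus d → F} (hf : IsContDiff 1 f)
    (v : EuclideanSpace ℝ d) : ∫ x, Torus.lineDeriv f x v = 0 := by
  -- continuity (hence boundedness) of `x ↦ ∂ᵥ f x`
  have hcont : Continuous fun x => Torus.lineDeriv f x v := by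
    rw [← continuous_lift_iff, lift_lineDeriv hf v]
    exact (ContDiff.continuous_fderiv hf one_ne_zero).clm_apply continuous_const
  obtain ⟨C, hC⟩ : ∃ C, ∀ x, ‖Torus.lineDeriv f x v‖ ≤ C := by
    obtain ⟨C, hC⟩ := isCompact_univ.exists_bound_of_continuousOn hcont.continuousOn
    exact ⟨C, fun x => hC x (mem_univ x)⟩
  set Φ : ℝ → UnitAddTorus d → F := fun s x => f (x + proj (s • v)) with hΦ
  have hderiv : HasDerivWithinAt (fun s => ∫ x, Φ s x) (∫ x, Torus.lineDeriv f (x + proj ((0 : ℝ) • v)) v)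
      univ 0 := by
    refine hasDerivWithinAt_integral_of_convex (F' := fun s x => Torus.lineDeriv f (x + proj (s • v)) v)
      convex_univ (mem_univ 0) (fun s _ => ?_) (fun s _ x => ?_) (C := C) ?_ ?_
    · exact (hf.continuous.comp (continuous_id.add continuous_const)).integrable_unitAddTorus
    · exact (hasDerivAt_comp_add_proj_smul hf x v s).hasDerivWithinAt
    · exact Eventually.of_forall fun s x => hC _
    · exact (hcont.comp (continuous_id.add continuous_const)).aestronglyMeasurable
  have hconst : (fun s => ∫ x, Φ s x) = fun _ => ∫ x, f x :=
    funext fun s => integral_add_right_eq_self f _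
  rw [hconst, hasDerivWithinAt_univ] at hderiv
  have h := (hasDerivAt_const (0 : ℝ) (∫ x, f x)).unique hderiv
  simpa using h.symm

/-- `∫_{𝕋ᵈ} ∂ᵢ f = 0` for `C¹` `f`. [cite: Evans2010, App. C.2 Thm. 1] -/
theorem integral_partialDeriv_eq_zero_of_isContDiff {f : UnitAddTorus d → F} (hf : IsContDiff 1 f)
    (i : d) : ∫ x, partialDeriv i f x = 0 :=
  integral_lineDeriv_eq_zero_of_isContDiff hf (EuclideanSpace.single i 1)

/-- **Divergence theorem on the torus for `C¹` fields**: `∫_{𝕋ᵈ} div u = 0`.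
[cite: Evans2010, App. C.2 Thm. 1] -/
theorem integral_divergence_eq_zero_of_isContDiff {u : UnitAddTorus d → EuclideanSpace ℝ d}
    (hu : IsContDiff 1 u) : ∫ x, divergence u x = 0 := by
  have hui : ∀ i, IsContDiff 1 (fun y => u y i) := fun i =>
    (EuclideanSpace.proj i : EuclideanSpace ℝ d →L[ℝ] ℝ).contDiff.comp hu
  have hcont : ∀ i, Continuous fun x => partialDeriv i (fun y => u y i) x := by
    intro i
    rw [← continuous_lift_iff]
    unfold partialDeriv
    rw [lift_lineDeriv (hui i)]
    exact (ContDiff.continuous_fderiv (hui i) one_ne_zero).clm_apply continuous_const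
  simp only [divergence]
  rw [integral_finsetSum _ fun i _ => (hcont i).integrable_unitAddTorus]
  exact Finset.sum_eq_zero fun i _ => integral_partialDeriv_eq_zero_of_isContDiff (hui i) i

end IBP

end Torus

end Literature.Analysis.FunctionSpaces
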